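import Summits.CriticalPhenomena.SAWScalingLimit.Theorems.SAWLoopFugacityFlowIsingBoundaryRatioWindowExtResistanceExtract
import HarnessLib

/-!
# Resistance bound for the window rectangle — chart toolkit
(line `fk-anchor-transfer`, crux `IsingBoundaryRatio`, stmt-CriticalPhenomena-10650; helper module of the proof of
`WindowExtResistanceBound`, `…IsingBoundaryRatioWindowResistanceDefs.lean`)

Analytic bookkeeping for the chordal chart `φ : ℍ → D` of a Dobrushin domain `(D; a, b)` along the chart
semicircles `θ ↦ φ(e^{s + iθ})`, `θ ∈ (0, π)` (the level lines `{|w| = e^s}` of the chart radius):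

* `wer_chart_setup` — the Carathéodory extension `g` of `φ⁻¹` (`exists_chart_extension`), a compact set `B`
  of `closure D ∖ {b}` containing every point of `closure D` within `d` of a point of chart radius `≤ R`
  (`φ⁻¹ → ∞` at `b`, `IsChordalUniformizing.tendsto_symm_cocompact`), on which `g` is real on `∂D`, has
  nonnegative imaginary part and is uniformly continuous (modulus `η` for a margin `m`); and, for all small
  meshes `δ`, every lattice site within `3δ` of a point of chart radius `≤ R` and chart height `≥ m` is a
  site of `Ω_δ` together with its four lattice edges (the compact set of such points has a compact closed
  thickening in `D`, whose lattice points belong to the largest mesh component,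
  `JordanDomain.exists_forall_mem_meshDomain_and_reachable`);
* `wer_exp_polar`, `wer_exp_mem_uhp` — `e^{s+iθ}` has norm `e^s`, real part `e^s cos θ`, imaginary part
  `e^s sin θ`, and lies in `ℍ` for `θ ∈ (0, π)`;
* `wer_re_lt_neg`, `wer_lt_re` — sign bookkeeping for chart points of small height;
* `wer_exists_near_frontier` — the semicircle comes arbitrarily close to `∂D` at both ends
  (Bolzano–Weierstrass: a limit point in `D` would have a real chart point).

All statements are folklore.
-/

noncomputable section

open scoped Classical Topology ENNReal NNReal
open Filter Set Metric SimpleGraph MeasureTheory Complex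
open Literature.Probability.LatticeModels Literature.Probability.RandomPlanarGeometry
open Literature.Probability.Percolation (BondConfig)
open UpperHalfPlane (upperHalfPlaneSet)

namespace Summit.CriticalPhenomena.SAWScalingLimit.Theorems.IsingBoundaryRatio

/-! ### The chart near a chart disc -/

/-- **Chart toolkit.** For the chordal chart `φ` of `(D; a, b)`, a chart radius `R` and a margin `m`:
the Carathéodory extension `g` of `φ⁻¹`, a compact set `B ⊆ closure D ∖ {b}` containing every point of
`closure D` within `d` of a point of chart radius `≤ R`, on which `g` has nonnegative imaginary part,
real on `∂D`, and modulus of uniform continuity `η` for `m`; and for all small meshes `δ`, every lattice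
site within `3δ` of a point of chart radius `≤ R` and chart height `≥ m` is a site of `Ω_δ` with its four
lattice edges in `Ω_δ` (the largest mesh component contains every compact, `MeshDomainJordan`). [folklore] -/
theorem wer_chart_setup {D : DobrushinDomain} {φ : ConformalEquiv upperHalfPlaneSet D.carrier}
    (hφ : D.IsChordalUniformizing φ) {R m : ℝ} (hm : 0 < m) :
    ∃ (g : ℂ → ℂ) (B : Set ℂ) (η d : ℝ), 0 < η ∧ 0 < d ∧
      EqOn g φ.symm D.carrier ∧
      (∀ z ∈ B, z ∈ frontier D.carrier → (g z).im = 0) ∧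
      (∀ z ∈ B, 0 ≤ (g z).im) ∧
      (∀ z ∈ D.carrier, ‖φ.symm z‖ ≤ R → ∀ z' ∈ closure D.carrier, dist z' z ≤ d → z' ∈ B) ∧
      (∀ z ∈ B, ∀ z' ∈ B, dist z z' < η → dist (g z) (g z') < m) ∧
      ∀ᶠ δ in 𝓝[>] (0 : ℝ), 16 * δ < η ∧ 16 * δ < d ∧
        ∀ z ∈ D.carrier, ‖φ.symm z‖ ≤ R → m ≤ (φ.symm z).im →
          ∀ x : Site 2, dist (meshPoint δ x) z ≤ 3 * δ →
            x ∈ meshDomain D.carrier δ ∧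
              ∀ k : Fin 4, (discreteDomainGraph D.carrier δ).Adj x (x + DiscreteRect.dir k) := by
  obtain ⟨g, hgc, hgeq, hgreal, -, -⟩ := exists_chart_extension hφ
  -- points of bounded chart radius are far from `b`
  have hcoc := hφ.tendsto_symm_cocompact
  obtain ⟨d₁, hd₁, hd₁ball⟩ := Metric.mem_nhdsWithin_iff.1
    (hcoc ((isCompact_closedBall (0 : ℂ) R).compl_mem_cocompact))
  have hfar : ∀ z ∈ D.carrier, ‖φ.symm z‖ ≤ R → d₁ ≤ dist z (D.pt 1) := by
    intro z hz hzr
    by_contra h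
    push Not at h
    have := hd₁ball ⟨Metric.mem_ball.2 h, hz⟩
    simp only [mem_preimage, mem_compl_iff, mem_closedBall, dist_zero_right, not_le] at this
    linarith
  set B : Set ℂ := closure D.carrier ∩ (ball (D.pt 1) (d₁ / 2))ᶜ with hB
  have hBc : IsCompact B := D.isBounded.isCompact_closure.inter_right isOpen_ball.isClosed_compl
  have hBsub : B ⊆ closure D.carrier \ {D.pt 1} := by
    rintro z ⟨hz, hzb⟩
    refine ⟨hz, fun h => hzb ?_⟩
    rw [mem_singleton_iff] at h
    rw [h]; exact Metric.mem_ball_self (half_pos hd₁)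
  have hgB : ContinuousOn g B := hgc.mono hBsub
  have hgim : ∀ z ∈ B, 0 ≤ (g z).im := by
    intro z hz
    have hz' := hBsub hz
    rw [closure_eq_self_union_frontier] at hz'
    rcases hz'.1 with h | h
    · rw [hgeq h]; exact le_of_lt (φ.symm_mapsTo h)
    · exact (hgreal z h hz'.2).ge
  have hgfr : ∀ z ∈ B, z ∈ frontier D.carrier → (g z).im = 0 := fun z hz hzf => hgreal z hzf (hBsub hz).2
  have hmemB : ∀ z ∈ D.carrier, ‖φ.symm z‖ ≤ R → ∀ z' ∈ closure D.carrier, dist z' z ≤ d₁ / 2 → z' ∈ B := by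
    intro z hz hzr z' hz' hd
    refine ⟨hz', fun h => ?_⟩
    rw [Metric.mem_ball] at h
    linarith [hfar z hz hzr, dist_triangle (D.pt 1) z' z, _root_.dist_comm z' (D.pt 1), _root_.dist_comm z (D.pt 1)]
  obtain ⟨η, hη, hηg⟩ := Metric.uniformContinuousOn_iff.1 (hBc.uniformContinuousOn_of_continuous hgB) m hm
  -- the compact set of deep points and its thickening
  set K : Set ℂ := B ∩ g ⁻¹' {w : ℂ | m ≤ w.im ∧ ‖w‖ ≤ R} with hK
  have hKcl : IsClosed K := by
    refine hgB.preimage_isClosed_of_isClosed hBc.isClosed ?_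
    exact (isClosed_le continuous_const Complex.continuous_im).inter (isClosed_le continuous_norm continuous_const)
  have hKc : IsCompact K := hBc.of_isClosed_subset hKcl inter_subset_left
  have hKD : K ⊆ D.carrier := by
    rintro z ⟨hzB, hzm, -⟩
    have hz' := (hBsub hzB).1
    rw [closure_eq_self_union_frontier] at hz'
    rcases hz' with h | h
    · exact h
    · exfalso
      have := hgfr z hzB h
      change m ≤ (g z).im at hzm
      linarith
  obtain ⟨dK, hdK, hthick⟩ := hKc.exists_cthickening_subset_open D.isOpen hKD
  have hK'c : IsCompact (cthickening dK K) := hKc.cthickening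
  obtain ⟨δ₀, hδ₀, hmesh⟩ :=
    JordanDomain.exists_forall_mem_meshDomain_and_reachable D.toJordanDomain hK'c hthick
  refine ⟨g, B, η, d₁ / 2, hη, half_pos hd₁, hgeq, hgfr, hgim, hmemB, hηg, ?_⟩
  have hpos : 0 < min (η / 16) (min (d₁ / 32) (min (dK / 4) δ₀)) := by positivity
  filter_upwards [Ioo_mem_nhdsGT hpos] with δ hδ
  obtain ⟨hδ0, hδlt⟩ := hδ
  simp only [lt_min_iff] at hδlt
  obtain ⟨h1, h2, h3, h4⟩ := hδlt
  refine ⟨by linarith, by linarith, fun z hz hzr hzm x hx => ?_⟩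
  have hzK : z ∈ K := by
    refine ⟨hmemB z hz hzr z (subset_closure hz) (by rw [_root_.dist_self]; positivity), ?_⟩
    show m ≤ (g z).im ∧ ‖g z‖ ≤ R
    rw [hgeq hz]; exact ⟨hzm, hzr⟩
  have hnearD : ∀ p : ℂ, dist p z ≤ 4 * δ → p ∈ D.carrier := fun p hp =>
    hthick (mem_cthickening_of_dist_le p z dK K hzK (by linarith))
  have hnearM : ∀ y : Site 2, dist (meshPoint δ y) z ≤ 4 * δ → y ∈ meshDomain D.carrier δ := fun y hy =>
    (hmesh δ hδ0 h4).1 y (mem_cthickening_of_dist_le _ z dK K hzK (by linarith))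
  have hdy : ∀ k : Fin 4, dist (meshPoint δ (x + DiscreteRect.dir k)) z ≤ 4 * δ := fun k => by
    linarith [dist_triangle (meshPoint δ (x + DiscreteRect.dir k)) (meshPoint δ x) z, wer_dist_add_dir hδ0 x k]
  refine ⟨hnearM x (by linarith), fun k => ?_⟩
  refine discreteDomainGraph_adj_iff.2 ⟨meshGraph_adj_iff.2 ⟨wer_adj_add_dir x k, ?_⟩, hnearM x (by linarith),
    hnearM _ (hdy k)⟩
  intro p hp
  refine subset_closure (hnearD p ?_)
  have hconv : segment ℝ (meshPoint δ x) (meshPoint δ (x + DiscreteRect.dir k)) ⊆ closedBall z (4 * δ) :=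
    (convex_closedBall z (4 * δ)).segment_subset (mem_closedBall.2 (by linarith)) (mem_closedBall.2 (hdy k))
  exact mem_closedBall.1 (hconv hp)

/-! ### Chart semicircles -/

/-- Sign bookkeeping: a complex number of norm `≥ 2m`, nonpositive real part and imaginary part of size
`< m` has real part `< -m`. [folklore] -/
theorem wer_re_lt_neg {w : ℂ} {m : ℝ} (hw : 2 * m ≤ ‖w‖) (hre : w.re ≤ 0) (him : |w.im| < m) : w.re < -m := by
  have h1 : ‖w‖ ^ 2 = w.re ^ 2 + w.im ^ 2 := by rw [← Complex.normSq_eq_norm_sq, Complex.normSq_apply]; ring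
  have hm : 0 < m := (abs_nonneg _).trans_lt him
  have h2 : w.im ^ 2 < m ^ 2 := by
    have := abs_lt.1 him; nlinarith
  have h3 : (2 * m) ^ 2 ≤ ‖w‖ ^ 2 := pow_le_pow_left₀ (by linarith) hw 2
  nlinarith

/-- Sign bookkeeping, mirror image: nonnegative real part forces real part `> m`. [folklore] -/
theorem wer_lt_re {w : ℂ} {m : ℝ} (hw : 2 * m ≤ ‖w‖) (hre : 0 ≤ w.re) (him : |w.im| < m) : m < w.re := by
  have h1 : ‖w‖ ^ 2 = w.re ^ 2 + w.im ^ 2 := by rw [← Complex.normSq_eq_norm_sq, Complex.normSq_apply]; ring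
  have hm : 0 < m := (abs_nonneg _).trans_lt him
  have h2 : w.im ^ 2 < m ^ 2 := by
    have := abs_lt.1 him; nlinarith
  have h3 : (2 * m) ^ 2 ≤ ‖w‖ ^ 2 := pow_le_pow_left₀ (by linarith) hw 2
  nlinarith

/-- The points `e^{s + iθ}` of the chart semicircle of radius `e^s`: norm, real and imaginary parts.
[folklore] -/
theorem wer_exp_polar (s θ : ℝ) :
    ‖exp ((s : ℂ) + (θ : ℂ) * I)‖ = Real.exp s ∧ (exp ((s : ℂ) + (θ : ℂ) * I)).re = Real.exp s * Real.cos θ ∧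
      (exp ((s : ℂ) + (θ : ℂ) * I)).im = Real.exp s * Real.sin θ := by
  refine ⟨?_, ?_, ?_⟩
  · rw [Complex.norm_exp]; simp
  · rw [Complex.exp_re]; simp
  · rw [Complex.exp_im]; simp

/-- For `θ ∈ (0, π)` the point `e^{s+iθ}` lies in the upper half-plane. [folklore] -/
theorem wer_exp_mem_uhp (s : ℝ) {θ : ℝ} (hθ : θ ∈ Ioo 0 Real.pi) : exp ((s : ℂ) + (θ : ℂ) * I) ∈ upperHalfPlaneSet := by
  show 0 < (exp ((s : ℂ) + (θ : ℂ) * I)).im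
  rw [(wer_exp_polar s θ).2.2]
  exact mul_pos (Real.exp_pos _) (Real.sin_pos_of_pos_of_lt_pi hθ.1 hθ.2)

/-- **The chart semicircle ends on `∂D`**: along any sequence of angles in `(0, π)` converging to an angle
with vanishing sine, the points `φ(e^{s+iθ_n})` come arbitrarily close to frontier points of `D`
(Bolzano–Weierstrass; a limit in `D` would have chart point on `ℝ`). [folklore] -/
theorem wer_exists_near_frontier_seq {D : DobrushinDomain} (φ : ConformalEquiv upperHalfPlaneSet D.carrier)
    (s : ℝ) {θ : ℕ → ℝ} (hθ : ∀ n, θ n ∈ Ioo 0 Real.pi) {θ₀ : ℝ} (hlim : Tendsto θ atTop (𝓝 θ₀))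
    (hsin : Real.sin θ₀ = 0) {ε : ℝ} (hε : 0 < ε) :
    ∃ n, ∃ p ∈ frontier D.carrier, dist p (φ (exp ((s : ℂ) + (θ n : ℂ) * I))) < ε := by
  set x : ℕ → ℂ := fun n => φ (exp ((s : ℂ) + (θ n : ℂ) * I)) with hx
  have hxD : ∀ n, x n ∈ D.carrier := fun n => φ.mapsTo (wer_exp_mem_uhp s (hθ n))
  obtain ⟨a, ha, ψ, hψ, hlim'⟩ := tendsto_subseq_of_bounded D.isBounded hxD
  have haD : a ∉ D.carrier := by
    intro haD
    have hcont : ContinuousAt φ.symm a :=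
      φ.symm.continuousOn.continuousAt (D.isOpen.mem_nhds haD)
    have h1 : Tendsto (fun n => φ.symm (x (ψ n))) atTop (𝓝 (φ.symm a)) := hcont.tendsto.comp hlim'
    have h2 : Tendsto (fun n => φ.symm (x (ψ n))) atTop (𝓝 (exp ((s : ℂ) + (θ₀ : ℂ) * I))) := by
      have heq : (fun n => φ.symm (x (ψ n))) = fun n => exp ((s : ℂ) + (θ (ψ n) : ℂ) * I) := by
        funext n
        exact φ.symm_apply_apply (wer_exp_mem_uhp s (hθ (ψ n)))
      rw [heq]
      have hθ' : Tendsto (fun n => θ (ψ n)) atTop (𝓝 θ₀) := hlim.comp hψ.tendsto_atTop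
      have hc : Continuous fun t : ℝ => exp ((s : ℂ) + (t : ℂ) * I) := by fun_prop
      exact (hc.tendsto θ₀).comp hθ'
    have heq := tendsto_nhds_unique h1 h2
    have him : (φ.symm a).im = 0 := by
      rw [heq, (wer_exp_polar s θ₀).2.2, hsin, mul_zero]
    have hpos : 0 < (φ.symm a).im := φ.symm_mapsTo haD
    linarith
  have hafr : a ∈ frontier D.carrier := by
    rw [frontier, D.isOpen.interior_eq]; exact ⟨ha, haD⟩
  have hev : ∀ᶠ n in atTop, dist (x (ψ n)) a < ε := Metric.tendsto_nhds.1 hlim' ε hε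
  obtain ⟨n, hn⟩ := hev.exists
  exact ⟨ψ n, a, hafr, by rw [_root_.dist_comm]; exact hn⟩

/-- The chart semicircle comes arbitrarily close to `∂D` at both ends. [folklore] -/
theorem wer_exists_near_frontier {D : DobrushinDomain} (φ : ConformalEquiv upperHalfPlaneSet D.carrier)
    (s : ℝ) {ε : ℝ} (hε : 0 < ε) :
    (∃ θ ∈ Ioo (Real.pi / 2) Real.pi, ∃ p ∈ frontier D.carrier, dist p (φ (exp ((s : ℂ) + (θ : ℂ) * I))) < ε) ∧
    (∃ θ ∈ Ioo 0 (Real.pi / 2), ∃ p ∈ frontier D.carrier, dist p (φ (exp ((s : ℂ) + (θ : ℂ) * I))) < ε) := by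
  have hπ := Real.pi_pos
  have hseq : Tendsto (fun n : ℕ => Real.pi / 2 / ((n : ℝ) + 2)) atTop (𝓝 0) := by
    have h2 : Tendsto (fun n : ℕ => (n : ℝ) + 2) atTop atTop :=
      tendsto_atTop_add_const_right _ _ tendsto_natCast_atTop_atTop
    exact tendsto_const_nhds.div_atTop h2
  have hbd : ∀ n : ℕ, 0 < Real.pi / 2 / ((n : ℝ) + 2) ∧ Real.pi / 2 / ((n : ℝ) + 2) < Real.pi / 2 := fun n =>
    ⟨by positivity, by
      rw [div_lt_iff₀ (by positivity)]; nlinarith⟩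
  constructor
  · obtain ⟨n, p, hp, hd⟩ := wer_exists_near_frontier_seq φ s (θ := fun n => Real.pi - Real.pi / 2 / ((n : ℝ) + 2))
      (fun n => ⟨by linarith [(hbd n).2], by linarith [(hbd n).1]⟩)
      (by simpa using tendsto_const_nhds.sub hseq) Real.sin_pi hε
    exact ⟨_, ⟨by linarith [(hbd n).2], by linarith [(hbd n).1]⟩, p, hp, hd⟩
  · obtain ⟨n, p, hp, hd⟩ := wer_exists_near_frontier_seq φ s (θ := fun n => Real.pi / 2 / ((n : ℝ) + 2))
      (fun n => ⟨(hbd n).1, by linarith [(hbd n).2]⟩) hseq Real.sin_zero hε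
    exact ⟨_, ⟨(hbd n).1, (hbd n).2⟩, p, hp, hd⟩

/-- `wer_exp_mem_uhp`, closed form (registered sub-goal of stmt-CriticalPhenomena-10650). [folklore] -/
theorem wer_exp_mem_uhp' : ∀ (s : ℝ) {θ : ℝ}, θ ∈ Ioo 0 Real.pi → exp ((s : ℂ) + (θ : ℂ) * I) ∈ upperHalfPlaneSet :=
  fun s _ hθ => wer_exp_mem_uhp s hθ

end Summit.CriticalPhenomena.SAWScalingLimit.Theorems.IsingBoundaryRatio

end
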